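import Mathlib
import HarnessLib
import Literature.Combinatorics.Additive.StepBeyondKempermanReduction

/-!
# Grynkiewicz 2009, §6 Claim 8: at most one unique expression element per summand element

[cite: Grynkiewicz2009, §6 Claim 8 (proof of Thm 4.1)] [tag: critical-pair] [tag: inverse-theorem]

Topic `Literature/Combinatorics/Additive`.  Cell `mm-stpp` (D-0046), seat `mm-stpp-lit` (gen 23); the
port of D. J. Grynkiewicz, *A step beyond Kemperman's structure theorem*, Mathematika **55** (2009)
67–114 continued.  §6, CASE I (`G` finite), **Claim 8** (print pp. 27–28): «`|N₁ᵇ(A, B)| ≤ 1` and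
`|N₁ᵃ(B, A)| ≤ 1`, for all `b ∈ B` and `a ∈ A`.  Suppose `|N₁ᵇ(A, B)| ≥ 2` for some `b ∈ B`.  If
`A + (B ∖ b)` is periodic with maximal period (say) `H`, then the non-extendibility of `B` implies that
`B ∖ b` is `H`-periodic, whence `B` is quasi-periodic, a contradiction to (47).  Hence `A + (B ∖ b)` is
aperiodic, whence Kneser's Theorem implies `|N₁ᵇ(A, B)| = 2`.  Thus we can apply KST to the pair
`(A, B ∖ b)`.  Since `⟨A⟩ = G` and since `A` is non-quasi-periodic (Claim 4), it follows that the
quasi-period from KST must be `G`.  Hence, since `|A|, |B ∖ b| > 1` (Claim 3), and since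
`|A + (B ∖ b)| ≤ |G| − 2` (in view of `|N₁ᵇ(A, B)| ≥ 2`), it follows from KST that both `A` and `B ∖ b`
are arithmetic progressions, whence Lemma 5.8 — which we can apply to `(A, B)` in view of Claims 1 and
3 — completes the proof.  So we can assume `|N₁ᵇ(A, B)| ≤ 1` for all `b ∈ B`.  Likewise, `|N₁ᵃ(B, A)| ≤ 1`
for all `a ∈ A`.»  Here `N₁ᵇ(A, B)` is the tree's `layerWith A B 1 {b}` (`QuasiPeriodicDecompositions.lean`;
`|N₁ᵇ(A, B)|` = the number of `a ∈ A` with `a + b` uniquely expressed, `card_layerWith_one_singleton`),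
KST is the tree's «only if» half of the Kemperman Structure Theorem for aperiodic sums
(`exists_isKempermanDecompI_of_not_isPeriodic'`, `KempermanDecompositionExistence.lean`), and Lemma 5.8
is `subsetDist_quasiProgression_of_isAP` (`QuasiProgressions.lean`).  The contradiction «`B` is
quasi-periodic» is with Claim 4 (the standing assumption that `B` is not quasi-periodic; (47) is not
needed), and the period `H` need not be maximal.

MAIN RESULTS (0 definitions, 0 named facts; everything PROVED).
* `Grynkiewicz2009.card_layerWith_le_one_or_seventeen` — Claim 8 for `B`: `G` finite, `0 ∈ A`,
  `|A|, |B| ≥ 3`, `|A + B| = |A| + |B|`, `A + B` aperiodic, `B` non-extendible w.r.t. `A`, `⟨A⟩ = G`,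
  `A`, `B` not quasi-periodic ⟹ `|N₁ᵇ(A, B)| ≤ 1` for every `b ∈ B`, or (17) holds.
* `Grynkiewicz2009.card_layerWith_le_one_and_or_seventeen` — both halves («Likewise»).

## References
* D. J. Grynkiewicz, *A step beyond Kemperman's structure theorem*, Mathematika 55 (2009) 67–114,
  doi:10.1112/S0025579300000966, §6 Claim 8 (pp. 27–28), §2 (`N_i^U`, KST), Lemma 5.8 (p. 20)
  [cite: Grynkiewicz2009, Thm 4.1 (proof, Claim 8)] — held `paper:doi-10-1112-s0025579300000966`,
  p0027–p0028 read 2026-08-29.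
* J. H. B. Kemperman, *On small sumsets in an abelian group*, Acta Math. 103 (1960) 63–88, Thm 5.1
  [cite: Kemperman1960, Thm 5.1].
-/

namespace Literature.Combinatorics.Additive

open Finset
open scoped Pointwise

universe u

variable {G : Type u} [AddCommGroup G] [DecidableEq G]

namespace Grynkiewicz2009

omit [DecidableEq G] in
/-- A coset containing a generating set through `0` is the whole group: `0 ∈ A`, `⟨A⟩ = G`,
`A ⊆ a + K` (`a ∈ A`) ⟹ `K = G` («since `⟨A⟩ = G` … the quasi-period from KST must be `G`»).
[cite: Grynkiewicz2009, §6 Claim 8] -/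
theorem eq_top_of_coset_of_closure_eq_top {A : Finset G} {K : AddSubgroup G} {a : G}
    (h0A : (0 : G) ∈ A) (hgen : AddSubgroup.closure (A : Set G) = ⊤)
    (hAK : ∀ x ∈ A, x - a ∈ K) : K = ⊤ := by
  rw [eq_top_iff, ← hgen]
  refine (AddSubgroup.closure_le K).2 fun x hx => ?_
  have ha : a ∈ K := by
    have := K.neg_mem (hAK 0 h0A)
    rwa [zero_sub, neg_neg] at this
  have := K.add_mem (hAK x (mem_coe.1 hx)) ha
  rwa [sub_add_cancel] at this

/-- **§6 Claim 8 (for `B`).**  `G` finite, `0 ∈ A`, `|A|, |B| ≥ 3`, `|A + B| = |A| + |B|`, `A + B`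
aperiodic, `B` non-extendible with respect to `A`, `⟨A⟩ = G`, `A` and `B` not quasi-periodic: then
`|N₁ᵇ(A, B)| ≤ 1` for every `b ∈ B`, or else (17) holds.  Proof as printed (module docstring):
`A + (B ∖ b) = (A + B) ∖ N₁^{≤b}` (`add_nsmul_add_sdiff_eq`) has at most `|A| + |B ∖ b| − 1` elements;
it is aperiodic (a period would make `B ∖ b` periodic by non-extendibility — a new element `h + y` of
`B` would not change `A + B`, and `h + y = b` would kill the unique expression elements `a + b` —, so
`B` quasi-periodic); KST (`exists_isKempermanDecompI_of_not_isPeriodic'`) gives a decomposition whose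
quasi-period contains the coset of the non-quasi-periodic generating set `A`, hence is `G`; the bottom
pair is then `(A, B ∖ b)` itself, of type (II) since `|A| ≥ 3`, `|B ∖ b| ≥ 2` exclude (I) and
`|A + (B ∖ b)| ≤ |G| − 2` excludes (III) (`|A| + |B ∖ b| = |G| + 1`) and (IV) (`|A| + |B ∖ b| = |G|`)
by Kneser; and Lemma 5.8 for the progression `A` gives (17).
[cite: Grynkiewicz2009, §6 Claim 8 (proof of Thm 4.1, pp. 27–28)] -/
theorem card_layerWith_le_one_or_seventeen [Fintype G] {A B : Finset G}
    (h0A : (0 : G) ∈ A) (hA3 : 3 ≤ #A) (hB3 : 3 ≤ #B) (hAB : #(A + B) = #A + #B)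
    (haper : (A + B).addStab = {0}) (hneB : IsNonExtendible B A)
    (hgen : AddSubgroup.closure (A : Set G) = ⊤) (hAqp : ¬ IsQuasiPeriodic A)
    (hBqp : ¬ IsQuasiPeriodic B) :
    (∀ b ∈ B, #(layerWith A B 1 {b}) ≤ 1) ∨
      ∃ α β : G, #(insert α A + insert β B) + 1 = #(insert α A) + #(insert β B) := by
  classical
  rw [or_iff_not_imp_left]
  intro hnot
  push Not at hnot
  obtain ⟨b, hb, h2⟩ := hnot
  set N := layerWith A B 1 {b} with hN
  set B' := B.erase b with hB'
  have hAne : A.Nonempty := ⟨0, h0A⟩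
  have hB'card : #B' = #B - 1 := card_erase_of_mem hb
  have hB'ne : B'.Nonempty := card_pos.1 (by omega)
  have hB'sub : B' ⊆ B := erase_subset b B
  -- `A + (B ∖ b) = (A + B) ∖ N₁^{≤b}`, `N ⊆ N₁^{≤b} ⊆ A + B`
  have hsplit : A + B' = (A + B) \ layerWithin A B 1 {b} := by
    have := add_nsmul_add_sdiff_eq (A := A) (B := B) (U := {b}) (i := 1) le_rfl
    rwa [Nat.sub_self, zero_nsmul, add_zero, one_nsmul, sdiff_singleton_eq_erase] at this
  have hNsub : N ⊆ layerWithin A B 1 {b} := fun x hx => by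
    rw [mem_layerWith] at hx
    rw [mem_layerWithin]
    exact ⟨hx.1, hx.2.le⟩
  have hWsub : layerWithin A B 1 {b} ⊆ A + B := fun x hx => by
    have := (mem_layerWithin.1 hx).1
    rwa [one_nsmul] at this
  have hcardAB' : #(A + B') + #(layerWithin A B 1 {b}) = #(A + B) := by
    rw [hsplit, card_sdiff_of_subset hWsub]
    have := card_le_card hWsub
    omega
  have hNle := card_le_card hNsub
  have hcrit : #(A + B') + 1 ≤ #A + #B' := by omega
  -- the elements of `N`: sums `a + b` uniquely expressed
  have hNmem : ∀ x ∈ N, x - b ∈ A ∧ ∀ a' ∈ A, ∀ y ∈ B, a' + y = x → y = b := by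
    intro x hx
    rw [mem_layerWith] at hx
    have hbx : b ∈ repTrace A B 1 x := by rw [hx.2]; exact mem_singleton_self _
    rw [mem_repTrace, Nat.sub_self, zero_nsmul, add_zero] at hbx
    refine ⟨hbx.2, fun a' ha' y hy he => ?_⟩
    have : y ∈ repTrace A B 1 x := by
      rw [mem_repTrace, Nat.sub_self, zero_nsmul, add_zero, ← he, add_sub_cancel_right]
      exact ⟨hy, ha'⟩
    rw [hx.2, mem_singleton] at this
    exact this
  -- `A + (B ∖ b)` is aperiodic
  have hap : ¬ IsPeriodic (A + B') := by
    rintro ⟨H, hH, hper⟩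
    apply hBqp
    have hB'per : IsPeriodicWith H B' := by
      intro h hh
      refine eq_of_subset_of_card_le (fun z hz => ?_) (by rw [card_vadd_finset])
      obtain ⟨y, hy, rfl⟩ := mem_vadd_finset.1 hz
      rw [vadd_eq_add]
      -- `A + (h + y) ⊆ A + (B ∖ b)`
      have hsub : ∀ a ∈ A, a + (h + y) ∈ A + B' := fun a ha => by
        have e : a + (h + y) = h +ᵥ (a + y) := by rw [vadd_eq_add]; abel
        rw [e, ← hper h hh]
        exact mem_vadd_finset.2 ⟨a + y, add_mem_add ha hy, rfl⟩
      have hyB : h + y ∈ B := by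
        by_contra hyB
        apply hneB _ hyB
        refine Subset.antisymm ?_ (add_subset_add_right (subset_insert _ _))
        intro z hz
        obtain ⟨u, hu, a, ha, rfl⟩ := mem_add.1 hz
        rw [mem_insert] at hu
        rcases hu with rfl | hu
        · have := hsub a ha
          rw [add_comm B A, add_comm (h + y) a]
          exact add_subset_add_left hB'sub this
        · exact add_mem_add hu ha
      have hyb : h + y ≠ b := by
        intro hyb
        obtain ⟨x, hx⟩ : N.Nonempty := card_pos.1 (by omega)
        obtain ⟨hxA, huniq⟩ := hNmem x hx
        have := hsub _ hxA
        rw [hyb, sub_add_cancel] at this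
        obtain ⟨a', ha', y', hy', he⟩ := mem_add.1 this
        have := huniq a' ha' y' (hB'sub hy') he
        rw [this] at hy'
        exact notMem_erase b B hy'
      exact mem_erase.2 ⟨hyb, hyB⟩
    refine ⟨H, B', {b}, ⟨hH, disjoint_singleton_right.2 (notMem_erase b B), ?_, hB'per, ?_⟩, hB'ne⟩
    · rw [union_comm, ← insert_eq, hB', insert_erase hb]
    · intro x hx y hy
      rw [mem_singleton] at hx hy
      rw [hx, hy, sub_self]; exact H.zero_mem
  -- KST for `(A, B ∖ b)`: the quasi-period is `G`
  haveI : Nontrivial G := by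
    rw [← Fintype.one_lt_card_iff_nontrivial]
    exact lt_of_lt_of_le (by omega : 1 < #A) (card_le_univ A)
  obtain ⟨H, A₁, A₀, B₁, B₀, hK⟩ := exists_isKempermanDecompI_of_not_isPeriodic' hAne hB'ne hcrit hap
  obtain ⟨-, hA₀⟩ := hK.decomp_left.left_eq_empty_of_not_isQuasiPeriodic hAqp
  have hHtop : H = ⊤ := by
    refine eq_top_of_coset_of_closure_eq_top (a := 0) h0A hgen fun x hx => ?_
    exact hK.decomp_left.sub_mem x (by rw [hA₀]; exact hx) 0 (by rw [hA₀]; exact h0A)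
  subst hHtop
  have hB₁ : B₁ = ∅ := by
    by_contra hne
    obtain ⟨y, hy⟩ := nonempty_iff_ne_empty.2 hne
    obtain ⟨z, hz⟩ := hK.right_nonempty
    have hzB₁ : z ∈ B₁ := by
      have := hK.decomp_right.periodic.add_mem (AddSubgroup.mem_top (z - y)) hy
      rwa [sub_add_cancel] at this
    exact disjoint_left.1 hK.decomp_right.disjoint hzB₁ hz
  have hB₀ : B₀ = B' := by
    have := hK.decomp_right.union_eq
    rwa [hB₁, empty_union] at this
  have hE := hK.elementary
  rw [hA₀, hB₀] at hE
  -- Kneser for the aperiodic `A + (B ∖ b)`, and `|A + (B ∖ b)| ≤ |G| − 2`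
  have hkn : #A + #B' ≤ #(A + B') + 1 := by
    have hper' : (A + B').addStab = {0} := by
      by_contra h
      exact hap ((isPeriodic_iff_addStab_ne (hAne.add hB'ne)).2 h)
    have hkn := add_kneser A B'
    rw [hper', Finset.singleton_zero, add_zero, add_zero, Finset.card_zero] at hkn
    exact hkn
  have hGcard : #(A + B') + 2 ≤ Fintype.card G := by
    have := card_le_univ (A + B)
    omega
  rcases hE with hI | hII | hIII | hIV
  · obtain ⟨-, -, h1⟩ := hI
    omega
  · obtain ⟨-, -, d, hAd, -, -⟩ := hII
    exact (subsetDist_quasiProgression_of_isAP hAB hA3 haper hAd).2.2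
  · obtain ⟨K, a, b', -, -, hAK, -, hcard, -⟩ := hIII
    have hKtop : K = ⊤ := eq_top_of_coset_of_closure_eq_top h0A hgen hAK
    subst hKtop
    rw [AddSubgroup.card_top, Nat.card_eq_fintype_card] at hcard
    omega
  · obtain ⟨K, a, b', g, -, -, hAK, -, -, -, -, hiff⟩ := hIV
    have hKtop : K = ⊤ := eq_top_of_coset_of_closure_eq_top h0A hgen hAK
    subst hKtop
    have hAeq : A = (B'ᶜ).image (fun y => g - y) := by
      ext x
      rw [mem_image]
      constructor
      · intro hx
        exact ⟨g - x, mem_compl.2 ((hiff x).1 hx).2, sub_sub_cancel g x⟩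
      · rintro ⟨y, hy, rfl⟩
        exact (hiff _).2 ⟨AddSubgroup.mem_top _, by rw [sub_sub_cancel]; exact mem_compl.1 hy⟩
    have hcardA : #A = Fintype.card G - #B' := by
      rw [hAeq, card_image_of_injective _ sub_right_injective, card_compl]
    have := card_le_univ B'
    omega

/-- **§6 Claim 8 (both halves, «Likewise, `|N₁ᵃ(B, A)| ≤ 1` for all `a ∈ A`»).**  Under the core-case
standing assumptions (`G` finite, `0 ∈ A ∩ B`, `|A|, |B| ≥ 3`, `|A + B| = |A| + |B|`, `A + B` aperiodic,
`(A, B)` non-extendible, `⟨A⟩ = ⟨B⟩ = G`, `A`, `B` not quasi-periodic): `|N₁ᵇ(A, B)| ≤ 1` for all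
`b ∈ B` and `|N₁ᵃ(B, A)| ≤ 1` for all `a ∈ A`, or else (17) holds.
[cite: Grynkiewicz2009, §6 Claim 8 (proof of Thm 4.1, pp. 27–28)] -/
theorem card_layerWith_le_one_and_or_seventeen [Fintype G] {A B : Finset G}
    (h0A : (0 : G) ∈ A) (h0B : (0 : G) ∈ B) (hA3 : 3 ≤ #A) (hB3 : 3 ≤ #B)
    (hAB : #(A + B) = #A + #B) (haper : (A + B).addStab = {0})
    (hneA : IsNonExtendible A B) (hneB : IsNonExtendible B A)
    (hgenA : AddSubgroup.closure (A : Set G) = ⊤) (hgenB : AddSubgroup.closure (B : Set G) = ⊤)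
    (hAqp : ¬ IsQuasiPeriodic A) (hBqp : ¬ IsQuasiPeriodic B) :
    ((∀ b ∈ B, #(layerWith A B 1 {b}) ≤ 1) ∧ ∀ a ∈ A, #(layerWith B A 1 {a}) ≤ 1) ∨
      ∃ α β : G, #(insert α A + insert β B) + 1 = #(insert α A) + #(insert β B) := by
  have hBA : #(B + A) = #B + #A := by rw [add_comm, hAB, add_comm]
  have haper' : (B + A).addStab = {0} := by rwa [add_comm]
  rcases card_layerWith_le_one_or_seventeen h0A hA3 hB3 hAB haper hneB hgenA hAqp hBqp with h₁ | h₁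
  · rcases card_layerWith_le_one_or_seventeen h0B hB3 hA3 hBA haper' hneA hgenB hBqp hAqp with h₂ | h₂
    · exact Or.inl ⟨h₁, h₂⟩
    · exact Or.inr (seventeen_symm h₂)
  · exact Or.inr h₁

end Grynkiewicz2009

end Literature.Combinatorics.Additive
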